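import Summits.ResolutionOfSingularities.ResolutionOfSingularities.Theorems.PurelyInseparableDim4ParamCertColumn1
import Summits.ResolutionOfSingularities.ResolutionOfSingularities.Theorems.PurelyInseparableDim4ParamCertColumn2
import Summits.ResolutionOfSingularities.ResolutionOfSingularities.Theorems.PurelyInseparableDim4ParamCertColumn3
import Summits.ResolutionOfSingularities.ResolutionOfSingularities.Theorems.PurelyInseparableDim4ParamCertColumn4
import Summits.ResolutionOfSingularities.ResolutionOfSingularities.Theorems.PurelyInseparableDim4ParamCertColumn5
import Summits.ResolutionOfSingularities.ResolutionOfSingularities.Theorems.PurelyInseparableDim4ParamCertColumn6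
import Summits.ResolutionOfSingularities.ResolutionOfSingularities.Theorems.PurelyInseparableDim4ParamCertColumn7
import Summits.ResolutionOfSingularities.ResolutionOfSingularities.Theorems.PurelyInseparableDim4ParamCertColumn8
import Summits.ResolutionOfSingularities.ResolutionOfSingularities.Theorems.PurelyInseparableDim4ParamCertColumn9
import Summits.ResolutionOfSingularities.ResolutionOfSingularities.Theorems.PurelyInseparableDim4ParamCertColumn10
import Summits.ResolutionOfSingularities.ResolutionOfSingularities.Theorems.PurelyInseparableDim4ParamCertColumn11
import Summits.ResolutionOfSingularities.ResolutionOfSingularities.Theorems.PurelyInseparableDim4ParamCertColumn12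
import Summits.ResolutionOfSingularities.ResolutionOfSingularities.Theorems.PurelyInseparableDim4ParamCertColumn13
import Summits.ResolutionOfSingularities.ResolutionOfSingularities.Theorems.PurelyInseparableDim4ParamCertColumn14
import Summits.ResolutionOfSingularities.ResolutionOfSingularities.Theorems.PurelyInseparableDim4ParamCertColumn15
import Summits.ResolutionOfSingularities.ResolutionOfSingularities.Theorems.PurelyInseparableDim4ParamCertColumn16
import Summits.ResolutionOfSingularities.ResolutionOfSingularities.Theorems.PurelyInseparableDim4ParamCertColumn17
import Summits.ResolutionOfSingularities.ResolutionOfSingularities.Theorems.PurelyInseparableDim4ParamCertColumn18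
import Summits.ResolutionOfSingularities.ResolutionOfSingularities.Theorems.PurelyInseparableDim4ParamCertColumn19
import Summits.ResolutionOfSingularities.ResolutionOfSingularities.Theorems.PurelyInseparableDim4ParamCertColumn20
import Summits.ResolutionOfSingularities.ResolutionOfSingularities.Theorems.PurelyInseparableDim4ParamCertColumn21
import Summits.ResolutionOfSingularities.ResolutionOfSingularities.Theorems.PurelyInseparableDim4ParamCertColumn22
import Summits.ResolutionOfSingularities.ResolutionOfSingularities.Theorems.PurelyInseparableDim4ParamCertColumn23
import Summits.ResolutionOfSingularities.ResolutionOfSingularities.Theorems.PurelyInseparableDim4ParamCertColumn24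
import Summits.ResolutionOfSingularities.ResolutionOfSingularities.Theorems.PurelyInseparableDim4ParamCertColumn25
import Summits.ResolutionOfSingularities.ResolutionOfSingularities.Theorems.PurelyInseparableDim4ParamCertColumn26
import Summits.ResolutionOfSingularities.ResolutionOfSingularities.Theorems.PurelyInseparableDim4ParamCertColumn27
import Summits.ResolutionOfSingularities.ResolutionOfSingularities.Theorems.PurelyInseparableDim4ParamCertColumn28
import Summits.ResolutionOfSingularities.ResolutionOfSingularities.Theorems.PurelyInseparableDim4ParamCertColumn29
import Summits.ResolutionOfSingularities.ResolutionOfSingularities.Theorems.PurelyInseparableDim4ParamCertColumn30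
import Summits.ResolutionOfSingularities.ResolutionOfSingularities.Theorems.PurelyInseparableDim4ParamCertColumn31
import Summits.ResolutionOfSingularities.ResolutionOfSingularities.Theorems.PurelyInseparableDim4ParamCertColumn32
import Summits.ResolutionOfSingularities.ResolutionOfSingularities.Theorems.PurelyInseparableDim4ParamCertColumn33
import Summits.ResolutionOfSingularities.ResolutionOfSingularities.Theorems.PurelyInseparableDim4ParamCertColumn34
import Summits.ResolutionOfSingularities.ResolutionOfSingularities.Theorems.PurelyInseparableDim4ParamCertColumn35
import Summits.ResolutionOfSingularities.ResolutionOfSingularities.Theorems.PurelyInseparableDim4ParamCertColumn36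
import Summits.ResolutionOfSingularities.ResolutionOfSingularities.Theorems.PurelyInseparableDim4ParamCertColumn37
import Summits.ResolutionOfSingularities.ResolutionOfSingularities.Theorems.PurelyInseparableDim4ParamCertColumn38
import Summits.ResolutionOfSingularities.ResolutionOfSingularities.Theorems.PurelyInseparableDim4ParamCertColumn39
import Summits.ResolutionOfSingularities.ResolutionOfSingularities.Theorems.PurelyInseparableDim4ParamCertColumn40
import Summits.ResolutionOfSingularities.ResolutionOfSingularities.Theorems.PurelyInseparableDim4ParamCertColumn41
import Summits.ResolutionOfSingularities.ResolutionOfSingularities.Theorems.PurelyInseparableDim4ParamCertColumn42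
import Summits.ResolutionOfSingularities.ResolutionOfSingularities.Theorems.PurelyInseparableDim4ParamCertColumn43
import Summits.ResolutionOfSingularities.ResolutionOfSingularities.Theorems.PurelyInseparableDim4ParamCertColumn44
import Summits.ResolutionOfSingularities.ResolutionOfSingularities.Theorems.PurelyInseparableDim4ParamCertColumn45
import Summits.ResolutionOfSingularities.ResolutionOfSingularities.Theorems.PurelyInseparableDim4ParamCertColumn46
import Summits.ResolutionOfSingularities.ResolutionOfSingularities.Theorems.PurelyInseparableDim4ParamCertColumn47
import Summits.ResolutionOfSingularities.ResolutionOfSingularities.Theorems.PurelyInseparableDim4ParamCertColumn48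
import Summits.ResolutionOfSingularities.ResolutionOfSingularities.Theorems.PurelyInseparableDim4ParamCertColumn49
import Summits.ResolutionOfSingularities.ResolutionOfSingularities.Theorems.PurelyInseparableDim4ParamCertColumn50
import Summits.ResolutionOfSingularities.ResolutionOfSingularities.Theorems.PurelyInseparableDim4ParamCertColumn51
import Summits.ResolutionOfSingularities.ResolutionOfSingularities.Theorems.PurelyInseparableDim4ParamCertColumn52
import HarnessLib

/-!
# [OURS · res-dim4-pi · F4-C-loc] (3,3) LOCAL binomial census — ROOT AGGREGATOR A: compact column files 1–52 (1776 roots)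

Cell `res-dim4-pi` (D-0157 DOOR 2, wave 2), seat `res-dim4-p-6` g5.  Bookkeeping only: the list `rootsA` of census roots
(presented `𝔽₃` states) certified in the imported kernel-certificate modules, and the theorem `rootsA_win` that every
listed root is an A-win of the LOCAL in-scope game `LoopCLocal.RWins 3 localB` over EVERY field of characteristic 3 —
assembled from the modules' own theorems (`Column<N>.localWin_of_mem_col`); no certificate is re-checked here.  Consumed by the «binomial class
theorem» (`…BinomialClassLocalWin`).

[OURS · counted 0 · bookkeeping; AI kernel work, weaker than expert review.]  NOTHING here is a statement about resolution
of singularities; resolution in dimension `≥ 4` / characteristic `p > 0` is NOT proved by anything in this file.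
bears_on: LADDER-RESOLUTION:D157-DOOR2 (res-dim4-pi · (3,3) LOCAL · aggregator).  Host item (DR-157-C):
`stmt-ResolutionOfSingularities-16155`, helper.
-/

set_option linter.dupNamespace false -- mandated namespace of this single-conjunct summit

noncomputable section

namespace Summit.ResolutionOfSingularities.ResolutionOfSingularities.Theorems.PIDim4

namespace LoopCLocal

open StepKit

namespace BinomialCensus

/-- roots of a compact column file, as presented states. OURS. [folklore] -/
def fstOf (col : List (SData 4 (ZMod 3) × PRowCert9 (ZMod 3) × List (PRow9 (ZMod 3)))) :
    List (SData 4 (ZMod 3)) :=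
  col.map Prod.fst

/-- transport of a column theorem to the root list. OURS. [folklore] -/
theorem win_fstOf (L : Type) [Field L] [CharP L 3] [DecidableEq L]
    {col : List (SData 4 (ZMod 3) × PRowCert9 (ZMod 3) × List (PRow9 (ZMod 3)))}
    (h : ∀ e ∈ col, RWins 3 localB (liftState L e.1.toState)) :
    ∀ s ∈ fstOf col, RWins 3 localB (liftState L s.toState) := by
  intro s hs
  obtain ⟨e, he, rfl⟩ := List.mem_map.mp hs
  exact h e he

/-- the root lists of compact column files 1–13. [OURS · data] -/
def rootsALists1 : List (List (SData 4 (ZMod 3))) :=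
  [fstOf Column1.col,
   fstOf Column2.col,
   fstOf Column3.col,
   fstOf Column4.col,
   fstOf Column5.col,
   fstOf Column6.col,
   fstOf Column7.col,
   fstOf Column8.col,
   fstOf Column9.col,
   fstOf Column10.col,
   fstOf Column11.col,
   fstOf Column12.col,
   fstOf Column13.col]

/-- every root list of files 1–13 is certified. OURS. [folklore] -/
theorem rootsALists1_win (L : Type) [Field L] [CharP L 3] [DecidableEq L] :
    ∀ l ∈ rootsALists1, ∀ s ∈ l, RWins 3 localB (liftState L s.toState) :=
  List.forall_mem_cons.mpr ⟨win_fstOf L (Column1.localWin_of_mem_col L),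
    List.forall_mem_cons.mpr ⟨win_fstOf L (Column2.localWin_of_mem_col L),
    List.forall_mem_cons.mpr ⟨win_fstOf L (Column3.localWin_of_mem_col L),
    List.forall_mem_cons.mpr ⟨win_fstOf L (Column4.localWin_of_mem_col L),
    List.forall_mem_cons.mpr ⟨win_fstOf L (Column5.localWin_of_mem_col L),
    List.forall_mem_cons.mpr ⟨win_fstOf L (Column6.localWin_of_mem_col L),
    List.forall_mem_cons.mpr ⟨win_fstOf L (Column7.localWin_of_mem_col L),
    List.forall_mem_cons.mpr ⟨win_fstOf L (Column8.localWin_of_mem_col L),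
    List.forall_mem_cons.mpr ⟨win_fstOf L (Column9.localWin_of_mem_col L),
    List.forall_mem_cons.mpr ⟨win_fstOf L (Column10.localWin_of_mem_col L),
    List.forall_mem_cons.mpr ⟨win_fstOf L (Column11.localWin_of_mem_col L),
    List.forall_mem_cons.mpr ⟨win_fstOf L (Column12.localWin_of_mem_col L),
    List.forall_mem_cons.mpr ⟨win_fstOf L (Column13.localWin_of_mem_col L),
    List.forall_mem_nil _⟩⟩⟩⟩⟩⟩⟩⟩⟩⟩⟩⟩⟩

/-- the root lists of compact column files 14–26. [OURS · data] -/
def rootsALists2 : List (List (SData 4 (ZMod 3))) :=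
  [fstOf Column14.col,
   fstOf Column15.col,
   fstOf Column16.col,
   fstOf Column17.col,
   fstOf Column18.col,
   fstOf Column19.col,
   fstOf Column20.col,
   fstOf Column21.col,
   fstOf Column22.col,
   fstOf Column23.col,
   fstOf Column24.col,
   fstOf Column25.col,
   fstOf Column26.col]

/-- every root list of files 14–26 is certified. OURS. [folklore] -/
theorem rootsALists2_win (L : Type) [Field L] [CharP L 3] [DecidableEq L] :
    ∀ l ∈ rootsALists2, ∀ s ∈ l, RWins 3 localB (liftState L s.toState) :=
  List.forall_mem_cons.mpr ⟨win_fstOf L (Column14.localWin_of_mem_col L),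
    List.forall_mem_cons.mpr ⟨win_fstOf L (Column15.localWin_of_mem_col L),
    List.forall_mem_cons.mpr ⟨win_fstOf L (Column16.localWin_of_mem_col L),
    List.forall_mem_cons.mpr ⟨win_fstOf L (Column17.localWin_of_mem_col L),
    List.forall_mem_cons.mpr ⟨win_fstOf L (Column18.localWin_of_mem_col L),
    List.forall_mem_cons.mpr ⟨win_fstOf L (Column19.localWin_of_mem_col L),
    List.forall_mem_cons.mpr ⟨win_fstOf L (Column20.localWin_of_mem_col L),
    List.forall_mem_cons.mpr ⟨win_fstOf L (Column21.localWin_of_mem_col L),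
    List.forall_mem_cons.mpr ⟨win_fstOf L (Column22.localWin_of_mem_col L),
    List.forall_mem_cons.mpr ⟨win_fstOf L (Column23.localWin_of_mem_col L),
    List.forall_mem_cons.mpr ⟨win_fstOf L (Column24.localWin_of_mem_col L),
    List.forall_mem_cons.mpr ⟨win_fstOf L (Column25.localWin_of_mem_col L),
    List.forall_mem_cons.mpr ⟨win_fstOf L (Column26.localWin_of_mem_col L),
    List.forall_mem_nil _⟩⟩⟩⟩⟩⟩⟩⟩⟩⟩⟩⟩⟩

/-- the root lists of compact column files 27–39. [OURS · data] -/
def rootsALists3 : List (List (SData 4 (ZMod 3))) :=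
  [fstOf Column27.col,
   fstOf Column28.col,
   fstOf Column29.col,
   fstOf Column30.col,
   fstOf Column31.col,
   fstOf Column32.col,
   fstOf Column33.col,
   fstOf Column34.col,
   fstOf Column35.col,
   fstOf Column36.col,
   fstOf Column37.col,
   fstOf Column38.col,
   fstOf Column39.col]

/-- every root list of files 27–39 is certified. OURS. [folklore] -/
theorem rootsALists3_win (L : Type) [Field L] [CharP L 3] [DecidableEq L] :
    ∀ l ∈ rootsALists3, ∀ s ∈ l, RWins 3 localB (liftState L s.toState) :=
  List.forall_mem_cons.mpr ⟨win_fstOf L (Column27.localWin_of_mem_col L),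
    List.forall_mem_cons.mpr ⟨win_fstOf L (Column28.localWin_of_mem_col L),
    List.forall_mem_cons.mpr ⟨win_fstOf L (Column29.localWin_of_mem_col L),
    List.forall_mem_cons.mpr ⟨win_fstOf L (Column30.localWin_of_mem_col L),
    List.forall_mem_cons.mpr ⟨win_fstOf L (Column31.localWin_of_mem_col L),
    List.forall_mem_cons.mpr ⟨win_fstOf L (Column32.localWin_of_mem_col L),
    List.forall_mem_cons.mpr ⟨win_fstOf L (Column33.localWin_of_mem_col L),
    List.forall_mem_cons.mpr ⟨win_fstOf L (Column34.localWin_of_mem_col L),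
    List.forall_mem_cons.mpr ⟨win_fstOf L (Column35.localWin_of_mem_col L),
    List.forall_mem_cons.mpr ⟨win_fstOf L (Column36.localWin_of_mem_col L),
    List.forall_mem_cons.mpr ⟨win_fstOf L (Column37.localWin_of_mem_col L),
    List.forall_mem_cons.mpr ⟨win_fstOf L (Column38.localWin_of_mem_col L),
    List.forall_mem_cons.mpr ⟨win_fstOf L (Column39.localWin_of_mem_col L),
    List.forall_mem_nil _⟩⟩⟩⟩⟩⟩⟩⟩⟩⟩⟩⟩⟩

/-- the root lists of compact column files 40–52. [OURS · data] -/
def rootsALists4 : List (List (SData 4 (ZMod 3))) :=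
  [fstOf Column40.col,
   fstOf Column41.col,
   fstOf Column42.col,
   fstOf Column43.col,
   fstOf Column44.col,
   fstOf Column45.col,
   fstOf Column46.col,
   fstOf Column47.col,
   fstOf Column48.col,
   fstOf Column49.col,
   fstOf Column50.col,
   fstOf Column51.col,
   fstOf Column52.col]

/-- every root list of files 40–52 is certified. OURS. [folklore] -/
theorem rootsALists4_win (L : Type) [Field L] [CharP L 3] [DecidableEq L] :
    ∀ l ∈ rootsALists4, ∀ s ∈ l, RWins 3 localB (liftState L s.toState) :=
  List.forall_mem_cons.mpr ⟨win_fstOf L (Column40.localWin_of_mem_col L),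
    List.forall_mem_cons.mpr ⟨win_fstOf L (Column41.localWin_of_mem_col L),
    List.forall_mem_cons.mpr ⟨win_fstOf L (Column42.localWin_of_mem_col L),
    List.forall_mem_cons.mpr ⟨win_fstOf L (Column43.localWin_of_mem_col L),
    List.forall_mem_cons.mpr ⟨win_fstOf L (Column44.localWin_of_mem_col L),
    List.forall_mem_cons.mpr ⟨win_fstOf L (Column45.localWin_of_mem_col L),
    List.forall_mem_cons.mpr ⟨win_fstOf L (Column46.localWin_of_mem_col L),
    List.forall_mem_cons.mpr ⟨win_fstOf L (Column47.localWin_of_mem_col L),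
    List.forall_mem_cons.mpr ⟨win_fstOf L (Column48.localWin_of_mem_col L),
    List.forall_mem_cons.mpr ⟨win_fstOf L (Column49.localWin_of_mem_col L),
    List.forall_mem_cons.mpr ⟨win_fstOf L (Column50.localWin_of_mem_col L),
    List.forall_mem_cons.mpr ⟨win_fstOf L (Column51.localWin_of_mem_col L),
    List.forall_mem_cons.mpr ⟨win_fstOf L (Column52.localWin_of_mem_col L),
    List.forall_mem_nil _⟩⟩⟩⟩⟩⟩⟩⟩⟩⟩⟩⟩⟩

/-- **the 1776 census roots of compact column files 1–52.** [OURS · data] -/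
def rootsA : List (SData 4 (ZMod 3)) :=
  rootsALists1.flatten ++ (rootsALists2.flatten ++ (rootsALists3.flatten ++ (rootsALists4.flatten)))

/-- **every listed root is a LOCAL A-win over every field of characteristic 3.** OURS. [folklore] -/
theorem rootsA_win (L : Type) [Field L] [CharP L 3] [DecidableEq L] :
    ∀ s ∈ rootsA, RWins 3 localB (liftState L s.toState) :=
  List.forall_mem_append.mpr ⟨List.forall_mem_flatten.mpr (rootsALists1_win L),
    List.forall_mem_append.mpr ⟨List.forall_mem_flatten.mpr (rootsALists2_win L),
    List.forall_mem_append.mpr ⟨List.forall_mem_flatten.mpr (rootsALists3_win L),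
    List.forall_mem_flatten.mpr (rootsALists4_win L)⟩⟩⟩

end BinomialCensus

end LoopCLocal

end Summit.ResolutionOfSingularities.ResolutionOfSingularities.Theorems.PIDim4

end
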